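import Summits.Ventures.QEC.CircuitDistance.ETowerZeroCert
import Summits.Ventures.QEC.CircuitDistance.ETowerSoundZ
import HarnessLib

/-!
# P3-PORT STEP 2 (E-fold tower), sector Z: THE STEP-A ZERO FIBRE from the brute-anchored certificates (§B10) and the
# assembly WITHOUT the `hZ` input (cell `qec`, experiment CDX, seat qec-cdx-type-1)

`zeroA_of_certsZ`: `GoodFibK GA 5 col2 9 NB 0` — the last non-data input of `SecZ.k2_bb144_Z_of_data` — from SIX data
facts per sector (emitter of record: eng-1 on idea-1's `emit_zeros345.py`, record order, W = 9): for each level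
P ∈ {C, B, A} the brute-anchored certificate (`ETowerZeroCert.zl`, blocks `b < 5`, `k < 4` further slots, fibre table
`tab TFC 72 / tab TFB 42 / tab TFA 24`, D-list `DC / DB / DA`) and the D-LIST NODE FACT (every listed half-word's double
passes the next continuation `ktop / nodeC / nodeB`).  Chain: `goodFibK_zero` at C (top `qTop_zero`) → at B → at A, each
fed by `zeroD_of_zcert` and the node soundness `hktopZ / hkCZ / hkBZ` (generic glue `goodQ_of_bits_doubleK`).
★ `k2_bb144_Z_of_certs`: `K2_BB144_Z` from units + windows + base slices + the six zero facts (no `hZ`).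
No `native_decide`; nothing here asserts a value of `d_circ`.
-/

set_option maxRecDepth 100000
set_option exponentiation.threshold 1024

namespace Summit.Ventures.QEC.CircuitDistance.ETower

open Summit.Ventures.QEC.Census Summit.Ventures.QEC.Census.Fold

/-- GENERIC GLUE (both sectors): a node fact on the support list of a DOUBLE gives the continuation at the double
(via the node's soundness `hnode`; `N = nK G nb` written as a numeral in the data). -/
theorem goodQ_of_bits_doubleK {G : Geo} {nb : ℕ} (hG : OKK G nb) {N : ℕ} (hN : nK G nb = N) {node : List ℕ → Bool}
    {Q : ℕ → Prop}
    (hnode : ∀ S, (∀ J ∈ S, J < nK G nb) → S.length = popc (nK G nb) (Fold.maskOf S) → node S = true →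
      Q (Fold.maskOf S))
    {c : ℕ} (h : node (bitsOf N 0 (doubleK G nb c)) = true) : Q (doubleK G nb c) := by
  have hlt : doubleK G nb c < 2 ^ N := hN ▸ doubleK_lt hG c
  have hm : Fold.maskOf (bitsOf N 0 (doubleK G nb c)) = doubleK G nb c := maskOf_bitsOf_zero _ _ hlt
  rw [← hm]
  refine hnode _ (fun J hJ => hN ▸ lt_of_mem_bitsOf hJ) ?_ h
  rw [hm, length_bitsOf, hN]

end Summit.Ventures.QEC.CircuitDistance.ETower

namespace Summit.Ventures.QEC.CircuitDistance.ETower.SecZ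

open Summit.Ventures.QEC.Census Summit.Ventures.QEC.Census.Fold Summit.Ventures.QEC.CircuitDistance.ETower K2

/-- ★ **THE STEP-A ZERO FIBRE of sector Z from the certificates.** -/
theorem zeroA_of_certsZ (hW3 : ∀ r ∈ W3C, NC r) {DA DB DC : List ℕ}
    (hzC : ∀ b, b < 5 → ∀ k, k < 4 →
      zl k (tab TFC 72) (matchedB 6 6 5 DC) (tab TFC 72 (b * 36)) (2 ^ (b * 36)) (b * 36 + 1) 180 = true)
    (hzB : ∀ b, b < 5 → ∀ k, k < 4 →
      zl k (tab TFB 42) (matchedB 6 3 5 DB) (tab TFB 42 (b * 18)) (2 ^ (b * 18)) (b * 18 + 1) 90 = true)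
    (hzA : ∀ b, b < 5 → ∀ k, k < 4 →
      zl k (tab TFA 24) (matchedB 3 3 5 DA) (tab TFA 24 (b * 9)) (2 ^ (b * 9)) (b * 9 + 1) 45 = true)
    (hdC : ∀ c ∈ DC, ktop (bitsOf 360 0 (doubleK GC 5 c)) = true)
    (hdB : ∀ c ∈ DB, nodeC (bitsOf 180 0 (doubleK GB 5 c)) = true)
    (hdA : ∀ c ∈ DA, nodeB (bitsOf 90 0 (doubleK GA 5 c)) = true) :
    GoodFibK GA 5 col2 9 NB 0 := by
  -- level C
  have hC0 : NC 0 := by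
    refine goodFibK_zero (G := GC) shapeC okC hK0 (Q := QT) hQTZ qTop_zero DC
      (zeroD_of_zcert (G := GC) (M := tab TFC 72) shapeC okC hMC hK0 (W := 9) (h := 4) (by norm_num) ?_) ?_
    · intro b hb k hk
      have e1 : GC.ls = 6 := by decide
      have e2 : GC.ms = 6 := by decide
      have e3 : nsK GC 5 = 180 := by decide
      rw [e1, e2, e3]; simp only [Nat.reduceMul]; exact hzC b hb k hk
    · intro c hc _
      exact goodQ_of_bits_doubleK okC (by decide) (node := ktop) (fun S hS hl h => hktopZ S hS hl h) (hdC c hc)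
  -- level B
  have hB0 : NB 0 := by
    refine goodFibK_zero (G := GB) shapeB okB hK1 (Q := NC) hNCZ hC0 DB
      (zeroD_of_zcert (G := GB) (M := tab TFB 42) shapeB okB hMB hK1 (W := 9) (h := 4) (by norm_num) ?_) ?_
    · intro b hb k hk
      have e1 : GB.ls = 6 := by decide
      have e2 : GB.ms = 3 := by decide
      have e3 : nsK GB 5 = 90 := by decide
      rw [e1, e2, e3]; simp only [Nat.reduceMul]; exact hzB b hb k hk
    · intro c hc _
      exact goodQ_of_bits_doubleK okB (by decide) (node := nodeC) (fun S hS _ h => hkCZ hW3 S hS h) (hdB c hc)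
  -- level A
  refine goodFibK_zero (G := GA) shapeA okA hK2 (Q := NB) hNBZ hB0 DA
    (zeroD_of_zcert (G := GA) (M := tab TFA 24) shapeA okA hMA hK2 (W := 9) (h := 4) (by norm_num) ?_) ?_
  · intro b hb k hk
    have e1 : GA.ls = 3 := by decide
    have e2 : GA.ms = 3 := by decide
    have e3 : nsK GA 5 = 45 := by decide
    rw [e1, e2, e3]; simp only [Nat.reduceMul]; exact hzA b hb k hk
  · intro c hc _
    exact goodQ_of_bits_doubleK okA (by decide) (node := nodeB) (fun S hS _ h => hkBZ hW3 S hS h) (hdA c hc)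

/-- ★★ **`K2_BB144_Z` from data only**: units, windows, base slices, and the six zero-fibre facts. -/
theorem k2_bb144_Z_of_certs {T3 DA DB DC : List ℕ}
    (hU : ∀ t ∈ T3, nodeA (bitsOf 45 0 t) = true)
    (hW : ∀ L ∈ W3L, ∀ w ∈ W3WIN3, nodeCW L w = true)
    (hBcheck : sliceCheck col3 3 3 5 9 T3 = true) (hBincr : Fibre.incr T3 = true)
    (hBsum : ∀ w, 1 ≤ w → w ≤ 9 → osum 3 3 5 w T3 = NW.getD w 0)
    (hzC : ∀ b, b < 5 → ∀ k, k < 4 →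
      zl k (tab TFC 72) (matchedB 6 6 5 DC) (tab TFC 72 (b * 36)) (2 ^ (b * 36)) (b * 36 + 1) 180 = true)
    (hzB : ∀ b, b < 5 → ∀ k, k < 4 →
      zl k (tab TFB 42) (matchedB 6 3 5 DB) (tab TFB 42 (b * 18)) (2 ^ (b * 18)) (b * 18 + 1) 90 = true)
    (hzA : ∀ b, b < 5 → ∀ k, k < 4 →
      zl k (tab TFA 24) (matchedB 3 3 5 DA) (tab TFA 24 (b * 9)) (2 ^ (b * 9)) (b * 9 + 1) 45 = true)
    (hdC : ∀ c ∈ DC, ktop (bitsOf 360 0 (doubleK GC 5 c)) = true)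
    (hdB : ∀ c ∈ DB, nodeC (bitsOf 180 0 (doubleK GB 5 c)) = true)
    (hdA : ∀ c ∈ DA, nodeB (bitsOf 90 0 (doubleK GA 5 c)) = true) : K2_BB144_Z :=
  k2_bb144_Z_of_data hU hW hBcheck hBincr hBsum
    (zeroA_of_certsZ (hW3_of_winsZ hW) hzC hzB hzA hdC hdB hdA)

end Summit.Ventures.QEC.CircuitDistance.ETower.SecZ
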